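import Literature.RepresentationTheory.HeisenbergGroup.SchrodingerPiGeneration
import Literature.NumberTheory.Weil1964.LocalLinearChangeOfVariables
import Literature.NumberTheory.Automorphic.TateSelfDualHaar
import HarnessLib

/-!
# The standard operators `r(n(c))`, `r(m(a))`, `r(w)` of the Schrödinger model on `𝒮(F^ι)` and their relations

Topic `RepresentationTheory/HeisenbergGroup`; namespace `Literature.RepresentationTheory.HeisenbergGroup`. KERNEL
mathematics only (definitions with bodies + theorems; no named fact, no `axiom`, no `sorry`).

`F` a non-archimedean local field with `2` invertible, `ψ` continuous non-trivial, `W = F^ι ⊕ F^ι` with the pairing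
`⟨x, y⟩ = Σ xᵢ yᵢ` (`dotProductBilin`), `Sp(W) = symplecticGroup (polar dotProductBilin)`, `ρ_ψ` the smooth
Schrödinger model on `𝒮(F^ι)` (`schrodingerSB`; translations by `X = F^ι ⊕ 0`, modulations by `Y = 0 ⊕ F^ι`).
This file fixes the UNITARILY NORMALISED standard operators of [Rangarao1993, Lemma 3.2, Thm 3.5 (2)] /
[Weil1964, n° 13] over the Siegel parabolic `P = P_Y` and the Weyl element, as automorphisms of `𝒮(F^ι)`
implementing the corresponding elements of `Sp(W)` (condition (A) of [MoeglinVignerasWaldspurger1987, Chap. 2 II.1]),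
and proves the RELATIONS among them which [Rangarao1993, Thm 3.5 (3)] packages as `r(p₁ σ p₂) = r(p₁) r(σ) r(p₂)`:

* §1 `unipOpPi c` = multiplication by `ψ(-½⟨x, c x⟩)` (Rao's `f_p(x)` factor; Weil's `t₀(f)`) for `c : F^ι → F^ι`
  (symmetric when it matters): additive in `c`, implements `n(c) : (x, y) ↦ (x, y + c x)`;
* §2 `leviOpPi a` = `Φ ↦ |det a|^{-1/2} Φ(a⁻¹ ·)` (Rao's `|a|^{1/2} φ(xa)` in left-action form), multiplicative in
  `a`, implements `m(a) = (a, a⁻ᵀ)` where `a⁻ᵀ = dualLeviPi a` is the contragredient for `⟨·,·⟩`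
  (`dotProductBilin_apply_dualLeviPi`); conjugation `m(a) n(c) m(a)⁻¹ = n(a⁻ᵀ c a⁻¹)` at operator level
  (`leviOpPi_mul_unipOpPi_mul_inv`);
* §3 `fourierOpPi` = the Fourier transform `Φ̂(η) = ∫ ψ(⟨x, η⟩) Φ(x) dμ^⊗ι` for the product of a SELF-DUAL Haar
  measure `μ` on `F` (Rao's `r(τ)`, (3.9); Weil's `d₀'(γ)`), implementing the Weyl element `w : (x, y) ↦ (y, -x)`;
  `ℱ ∘ ℱ = r(m(-1))` (`Φ ↦ Φ(-·)`; Rao Thm 3.5 proof: "`r(τ_S)² = r(a_S)`") and the contragredient rule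
  `ℱ ∘ r(m(a)) = r(m(a⁻ᵀ)) ∘ ℱ` (the module `‖det a‖` of [WeilBNT1967, Chap. I §2 Th. 3 Cor. 3] against the
  normalisation `|det a|^{-1/2}`).

## References

* [Rangarao1993] R. Ranga Rao, *On some explicit formulas in the theory of Weil representation*, Pacific J. Math.
  157 (1993) 335–371: §3.1 (3.9), Lemma 3.2 (3.8), Thm 3.5 (2)–(4).
* [Weil1964] A. Weil, *Sur certains groupes d'opérateurs unitaires*, Acta Math. 111 (1964), n° 6, n° 13 (p. 160).
* [MoeglinVignerasWaldspurger1987] C. Mœglin, M.-F. Vignéras, J.-L. Waldspurger, *Correspondances de Howe sur un corps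
  p-adique*, LNM 1291, Chap. 2 II.1 (A), II.6.
* [WeilBNT1967] A. Weil, *Basic Number Theory*, Chap. I §2 Th. 3 Cor. 3; Chap. VII §2 Cor. 3.
-/

set_option autoImplicit false

noncomputable section

namespace Literature.RepresentationTheory.HeisenbergGroup

open _root_.MeasureTheory Matrix
open scoped NNReal
open Literature.NumberTheory.Automorphic
open Literature.NumberTheory.GaloisRepresentations.IsNonarchimedeanLocalField
open Literature.NumberTheory.Weil1964



/-! ## §0 Linear algebra of `F^ι`: the functions `½⟨x, cx⟩`, transpose and contragredient -/

section Algebra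

variable {F : Type*} [Field F] {ι : Type*} [Fintype ι] [DecidableEq ι]

/-- two vectors with the same pairings against every vector are equal (test on `Pi.single i 1`). [folklore] -/
private theorem eq_of_forall_dotProduct_eq {v w : ι → F} (h : ∀ x : ι → F, x ⬝ᵥ v = x ⬝ᵥ w) : v = w := by
  funext i
  have := h (Pi.single i 1)
  simpa only [dotProduct, Pi.single_apply, ite_mul, one_mul, zero_mul, Finset.sum_ite_eq', Finset.mem_univ,
    if_true] using this

/-- Rao's second-degree function `½⟨x, c x⟩` of the unipotent `n(c)`. [cite: Rangarao1993, Lemma 3.1 (q_σ), p. 351] -/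
def halfForm [Invertible (2 : F)] (c : (ι → F) →ₗ[F] (ι → F)) (x : ι → F) : F := ⅟(2 : F) * dotProductBilin F F x (c x)

omit [DecidableEq ι] in
/-- formula. [cite: Rangarao1993, Lemma 3.1, p. 351] -/
theorem halfForm_apply [Invertible (2 : F)] (c : (ι → F) →ₗ[F] (ι → F)) (x : ι → F) :
    halfForm c x = ⅟(2 : F) * (x ⬝ᵥ c x) := rfl

omit [DecidableEq ι] in
/-- additivity `½⟨x, (c + c')x⟩ = ½⟨x, cx⟩ + ½⟨x, c'x⟩`. [cite: Weil1964, n° 6, p. 151] -/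
theorem halfForm_add [Invertible (2 : F)] (c c' : (ι → F) →ₗ[F] (ι → F)) :
    halfForm (c + c') = halfForm c + halfForm c' := by
  funext x
  simp only [halfForm, Pi.add_apply, LinearMap.add_apply, map_add, mul_add]

omit [DecidableEq ι] in
/-- `½⟨x, 0⟩ = 0`. [cite: Weil1964, n° 6, p. 151] -/
theorem halfForm_zero [Invertible (2 : F)] : halfForm (0 : (ι → F) →ₗ[F] (ι → F)) = 0 := by
  funext x
  simp only [halfForm, LinearMap.zero_apply, map_zero, mul_zero, Pi.zero_apply]

/-- the **transpose** `aᵀ` of an automorphism of `F^ι` for the pairing `⟨·,·⟩` (matrix transpose in the standard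
basis), as a linear automorphism. [cite: Rangarao1993, §2.2 (matrix notation), p. 338] -/
def transposePi (a : (ι → F) ≃ₗ[F] (ι → F)) : (ι → F) ≃ₗ[F] (ι → F) where
  toFun y := (LinearMap.toMatrix' (a : (ι → F) →ₗ[F] (ι → F)))ᵀ *ᵥ y
  map_add' y y' := Matrix.mulVec_add _ _ _
  map_smul' t y := Matrix.mulVec_smul _ _ _
  invFun y := (LinearMap.toMatrix' (a.symm : (ι → F) →ₗ[F] (ι → F)))ᵀ *ᵥ y
  left_inv y := by
    show (LinearMap.toMatrix' (a.symm : (ι → F) →ₗ[F] (ι → F)))ᵀ *ᵥ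
      ((LinearMap.toMatrix' (a : (ι → F) →ₗ[F] (ι → F)))ᵀ *ᵥ y) = y
    rw [Matrix.mulVec_mulVec, ← Matrix.transpose_mul, ← LinearMap.toMatrix'_comp]
    have : ((a : (ι → F) →ₗ[F] (ι → F)) ∘ₗ (a.symm : (ι → F) →ₗ[F] (ι → F))) = LinearMap.id := by
      apply LinearMap.ext; intro x; simp
    rw [this, LinearMap.toMatrix'_id, Matrix.transpose_one, Matrix.one_mulVec]
  right_inv y := by
    show (LinearMap.toMatrix' (a : (ι → F) →ₗ[F] (ι → F)))ᵀ *ᵥ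
      ((LinearMap.toMatrix' (a.symm : (ι → F) →ₗ[F] (ι → F)))ᵀ *ᵥ y) = y
    rw [Matrix.mulVec_mulVec, ← Matrix.transpose_mul, ← LinearMap.toMatrix'_comp]
    have : ((a.symm : (ι → F) →ₗ[F] (ι → F)) ∘ₗ (a : (ι → F) →ₗ[F] (ι → F))) = LinearMap.id := by
      apply LinearMap.ext; intro x; simp
    rw [this, LinearMap.toMatrix'_id, Matrix.transpose_one, Matrix.one_mulVec]

/-- formula. [cite: Rangarao1993, §2.2, p. 338] -/
theorem transposePi_apply (a : (ι → F) ≃ₗ[F] (ι → F)) (y : ι → F) :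
    transposePi a y = (LinearMap.toMatrix' (a : (ι → F) →ₗ[F] (ι → F)))ᵀ *ᵥ y := rfl

/-- the defining identity of the transpose: `⟨x, aᵀ y⟩ = ⟨a x, y⟩`. [cite: Rangarao1993, §2.2, p. 338] -/
theorem dotProductBilin_transposePi (a : (ι → F) ≃ₗ[F] (ι → F)) (x y : ι → F) :
    dotProductBilin F F x (transposePi a y) = dotProductBilin F F (a x) y := by
  rw [dotProductBilin_apply_apply, dotProductBilin_apply_apply, transposePi_apply, Matrix.dotProduct_mulVec,
    Matrix.vecMul_transpose, LinearMap.toMatrix'_mulVec, LinearEquiv.coe_coe, dotProduct_comm]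

/-- the same with `⬝ᵥ`. [cite: Rangarao1993, §2.2, p. 338] -/
theorem dotProduct_transposePi (a : (ι → F) ≃ₗ[F] (ι → F)) (x y : ι → F) : x ⬝ᵥ transposePi a y = a x ⬝ᵥ y := by
  have h := dotProductBilin_transposePi a x y
  rwa [dotProductBilin_apply_apply, dotProductBilin_apply_apply] at h

/-- `(aᵀ)⁻¹ = (a⁻¹)ᵀ`. [cite: Rangarao1993, §2.2, p. 338] -/
theorem transposePi_symm (a : (ι → F) ≃ₗ[F] (ι → F)) : (transposePi a).symm = transposePi a.symm := by
  apply LinearEquiv.ext; intro y; rfl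

/-- `(a a')ᵀ = a'ᵀ aᵀ`, i.e. `transposePi (a * a') = transposePi a' * transposePi a` in `GL(F^ι)`
(`(a * a') x = a (a' x)`). [cite: Rangarao1993, §2.2, p. 338] -/
theorem transposePi_mul (a a' : (ι → F) ≃ₗ[F] (ι → F)) :
    transposePi (a * a') = transposePi a' * transposePi a := by
  apply LinearEquiv.ext; intro y
  refine eq_of_forall_dotProduct_eq fun x => ?_
  rw [dotProduct_transposePi, LinearEquiv.mul_apply, LinearEquiv.mul_apply, dotProduct_transposePi,
    dotProduct_transposePi]

/-- `(aᵀ)ᵀ = a`. [cite: Rangarao1993, §2.2, p. 338] -/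
theorem transposePi_transposePi (a : (ι → F) ≃ₗ[F] (ι → F)) : transposePi (transposePi a) = a := by
  apply LinearEquiv.ext; intro y
  refine eq_of_forall_dotProduct_eq fun x => ?_
  rw [dotProduct_transposePi, dotProduct_comm (transposePi a x) y, dotProduct_transposePi, dotProduct_comm]

/-- `det aᵀ = det a`. [cite: WeilBNT1967, Chap. I §2 Th. 3 Cor. 3] -/
theorem det_transposePi (a : (ι → F) ≃ₗ[F] (ι → F)) :
    LinearMap.det ((transposePi a : (ι → F) ≃ₗ[F] (ι → F)) : (ι → F) →ₗ[F] (ι → F)) =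
      LinearMap.det (a : (ι → F) →ₗ[F] (ι → F)) := by
  have h : ((transposePi a : (ι → F) ≃ₗ[F] (ι → F)) : (ι → F) →ₗ[F] (ι → F)) =
      Matrix.toLin' (LinearMap.toMatrix' (a : (ι → F) →ₗ[F] (ι → F)))ᵀ := by
    apply LinearMap.ext; intro y
    rw [LinearEquiv.coe_coe, transposePi_apply, Matrix.toLin'_apply]
  rw [h, LinearMap.det_toLin', Matrix.det_transpose, LinearMap.det_toMatrix']

/-- the **contragredient** `a⁻ᵀ = (a⁻¹)ᵀ` of `a` for `⟨·,·⟩` (the `d` of the Levi element `m(a) = (a, a⁻ᵀ)`; Weil's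
`α*⁻¹`, MVW's `a*⁻¹`). [cite: Weil1964, n° 6, p. 151] -/
def dualLeviPi (a : (ι → F) ≃ₗ[F] (ι → F)) : (ι → F) ≃ₗ[F] (ι → F) := transposePi a.symm

/-- **`⟨a x, a⁻ᵀ y⟩ = ⟨x, y⟩`**. [cite: Weil1964, n° 6, p. 151] -/
theorem dotProductBilin_apply_dualLeviPi (a : (ι → F) ≃ₗ[F] (ι → F)) (x y : ι → F) :
    dotProductBilin F F (a x) (dualLeviPi a y) = dotProductBilin F F x y := by
  rw [dualLeviPi, dotProductBilin_transposePi, LinearEquiv.symm_apply_apply]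

/-- `⟨x, a⁻ᵀ y⟩ = ⟨a⁻¹ x, y⟩`. [cite: Weil1964, n° 6, p. 151] -/
theorem dotProductBilin_dualLeviPi (a : (ι → F) ≃ₗ[F] (ι → F)) (x y : ι → F) :
    dotProductBilin F F x (dualLeviPi a y) = dotProductBilin F F (a.symm x) y := by
  rw [dualLeviPi, dotProductBilin_transposePi]

/-- `⟨x, a⁻ᵀ y⟩ = ⟨a⁻¹ x, y⟩` with `⬝ᵥ`. [cite: Weil1964, n° 6, p. 151] -/
theorem dotProduct_dualLeviPi (a : (ι → F) ≃ₗ[F] (ι → F)) (x y : ι → F) : x ⬝ᵥ dualLeviPi a y = a.symm x ⬝ᵥ y :=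
  dotProduct_transposePi a.symm x y

/-- `(a a')⁻ᵀ = a⁻ᵀ a'⁻ᵀ`. [cite: Weil1964, n° 6, p. 151] -/
theorem dualLeviPi_mul (a a' : (ι → F) ≃ₗ[F] (ι → F)) : dualLeviPi (a * a') = dualLeviPi a * dualLeviPi a' := by
  have h : (a * a').symm = a'.symm * a.symm := by
    apply LinearEquiv.ext; intro x
    rw [LinearEquiv.mul_apply, LinearEquiv.symm_apply_eq, LinearEquiv.mul_apply, LinearEquiv.apply_symm_apply,
      LinearEquiv.apply_symm_apply]
  rw [dualLeviPi, dualLeviPi, dualLeviPi, h, transposePi_mul]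

/-- `1⁻ᵀ = 1`. [cite: Weil1964, n° 6, p. 151] -/
theorem dualLeviPi_one : dualLeviPi (1 : (ι → F) ≃ₗ[F] (ι → F)) = 1 := by
  apply LinearEquiv.ext; intro y
  refine eq_of_forall_dotProduct_eq fun x => ?_
  rw [dotProduct_dualLeviPi]
  rfl

/-- `(a⁻ᵀ)⁻ᵀ = a`. [cite: Weil1964, n° 6, p. 151] -/
theorem dualLeviPi_dualLeviPi (a : (ι → F) ≃ₗ[F] (ι → F)) : dualLeviPi (dualLeviPi a) = a := by
  rw [dualLeviPi, dualLeviPi, transposePi_symm, LinearEquiv.symm_symm, transposePi_transposePi]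

/-- `(a⁻ᵀ)⁻¹ = aᵀ`. [cite: Weil1964, n° 6, p. 151] -/
theorem dualLeviPi_symm (a : (ι → F) ≃ₗ[F] (ι → F)) : (dualLeviPi a).symm = transposePi a := by
  rw [dualLeviPi, transposePi_symm, LinearEquiv.symm_symm]

/-- `det a⁻ᵀ = (det a)⁻¹`. [cite: WeilBNT1967, Chap. I §2 Th. 3 Cor. 3] -/
theorem det_dualLeviPi (a : (ι → F) ≃ₗ[F] (ι → F)) :
    LinearMap.det ((dualLeviPi a : (ι → F) ≃ₗ[F] (ι → F)) : (ι → F) →ₗ[F] (ι → F)) =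
      (LinearMap.det (a : (ι → F) →ₗ[F] (ι → F)))⁻¹ := by
  rw [dualLeviPi, det_transposePi, LinearEquiv.det_coe_symm]

end Algebra

section Ops

variable {F : Type*} [Field F] [ValuativeRel F] [TopologicalSpace F] [IsNonarchimedeanLocalField F]
  {ι : Type*} [Fintype ι] [DecidableEq ι] [Invertible (2 : F)]
  {ψ : AddChar F Circle} (hl : IsLocallyConstant (⇑ψ : F → Circle))
  (hb : ∀ y : ι → F, Continuous fun u : ι → F => dotProductBilin F F u y)

/-! ## §1 The unipotent operators `r(n(c))` -/

omit [ValuativeRel F] [IsNonarchimedeanLocalField F] [DecidableEq ι] in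
/-- `x ↦ ½⟨x, c x⟩` is continuous. [cite: Rangarao1993, Lemma 3.2, p. 351] -/
theorem continuous_halfForm [IsTopologicalRing F] (c : (ι → F) →ₗ[F] (ι → F)) : Continuous (halfForm c) := by
  have hc : Continuous c := c.continuous_on_pi
  refine continuous_const.mul ?_
  simp only [dotProductBilin_apply_apply, dotProduct]
  exact continuous_finsetSum _ fun i _ => (continuous_apply i).mul ((continuous_apply i).comp hc)

/-- **the unipotent operator `r(n(c))`**: multiplication by `ψ(-½⟨x, c x⟩)` on `𝒮(F^ι)` (Rao's (3.8) with `a = 1`,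
in the left-action convention of the tree's `unipotentOp`). [cite: Rangarao1993, Lemma 3.2 (1), (3.8), p. 351] -/
def unipOpPi (c : (ι → F) →ₗ[F] (ι → F)) : SchwartzBruhat (ι → F) ≃ₗ[ℂ] SchwartzBruhat (ι → F) :=
  unipotentEquivSB ψ hl (halfForm c) (continuous_halfForm c)

omit [DecidableEq ι] in
/-- formula `(r(n(c)) Φ)(u) = ψ(-½⟨u, cu⟩) Φ(u)`. [cite: Rangarao1993, Lemma 3.2 (1), (3.8), p. 351] -/
@[simp] theorem coe_unipOpPi_apply (c : (ι → F) →ₗ[F] (ι → F)) (f : SchwartzBruhat (ι → F)) (u : ι → F) :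
    ((unipOpPi hl c f : SchwartzBruhat (ι → F)) : (ι → F) → ℂ) u = (ψ (-halfForm c u) : ℂ) * (f : (ι → F) → ℂ) u := by
  rw [unipOpPi, coe_unipotentEquivSB, unipotentOp_apply]

omit [DecidableEq ι] in
/-- **`r(n(c + c')) = r(n(c)) r(n(c'))`** (`t₀` is a homomorphism). [cite: Weil1964, n° 6, p. 151; Rangarao1993, Thm 3.5 (3)] -/
theorem unipOpPi_add (c c' : (ι → F) →ₗ[F] (ι → F)) : unipOpPi hl (c + c') = unipOpPi hl c * unipOpPi hl c' := by
  apply LinearEquiv.ext; intro f; apply Subtype.ext; funext u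
  rw [LinearEquiv.mul_apply, coe_unipOpPi_apply, coe_unipOpPi_apply, coe_unipOpPi_apply, halfForm_add, Pi.add_apply,
    neg_add, AddChar.map_add_eq_mul, Circle.coe_mul]
  ring

omit [DecidableEq ι] in
/-- `r(n(0)) = 1`. [cite: Weil1964, n° 6, p. 151] -/
theorem unipOpPi_zero : unipOpPi hl (0 : (ι → F) →ₗ[F] (ι → F)) = 1 := by
  apply LinearEquiv.ext; intro f; apply Subtype.ext; funext u
  rw [coe_unipOpPi_apply, halfForm_zero, Pi.zero_apply, neg_zero, AddChar.map_zero_eq_one, Circle.coe_one, one_mul]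
  rfl

omit [DecidableEq ι] in
/-- `r(n(-c)) = r(n(c))⁻¹`. [cite: Weil1964, n° 6, p. 151] -/
theorem unipOpPi_neg (c : (ι → F) →ₗ[F] (ι → F)) : unipOpPi hl (-c) = (unipOpPi hl c)⁻¹ := by
  rw [eq_inv_iff_mul_eq_one, ← unipOpPi_add, neg_add_cancel, unipOpPi_zero]

omit [DecidableEq ι] in
/-- **`(n(c), r(n(c))) ∈ S̃p_ψ(W)`** for `c` symmetric: the operator implements the unipotent element.
[cite: MoeglinVignerasWaldspurger1987, Chap. 2 II.6; Rangarao1993, Lemma 3.2 (1)] -/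
theorem unipotent_unipOpPi_mem_MpPsi (c : (ι → F) →ₗ[F] (ι → F))
    (hc : ∀ x x' : ι → F, dotProductBilin F F x (c x') = dotProductBilin F F x' (c x)) :
    (unipotentSp (dotProductBilin F F (m := ι)) c hc, unipOpPi hl c) ∈ MpPsi (schrodingerSB (dotProductBilin F F) ψ hl hb) :=
  unipotent_mem_MpPsi (dotProductBilin F F) ψ hl hb c hc (continuous_halfForm c)

/-! ## §2 The Levi operators `r(m(a))` -/

/-- **the unitary normalising factor `|det a|^{1/2}`** (a positive real). [cite: Rangarao1993, Lemma 3.2 (1), (3.8), p. 351] -/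
def modSqrt (a : (ι → F) ≃ₗ[F] (ι → F)) : ℝ :=
  Real.sqrt (normAbs F (LinearMap.det (a : (ι → F) →ₗ[F] (ι → F))))

omit [Fintype ι] [DecidableEq ι] [Invertible (2 : F)] in
/-- `|det a| > 0`. [cite: WeilBNT1967, Chap. I §2 Th. 3 Cor. 3] -/
theorem normAbs_det_pos (a : (ι → F) ≃ₗ[F] (ι → F)) :
    0 < (normAbs F (LinearMap.det (a : (ι → F) →ₗ[F] (ι → F))) : ℝ) := by
  have hdet : LinearMap.det (a : (ι → F) →ₗ[F] (ι → F)) ≠ 0 := by simpa using (LinearEquiv.isUnit_det' a).ne_zero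
  have h : normAbs F (LinearMap.det (a : (ι → F) →ₗ[F] (ι → F))) ≠ 0 := (map_ne_zero (normAbs F)).2 hdet
  exact_mod_cast pos_iff_ne_zero.2 h

omit [Fintype ι] [DecidableEq ι] [Invertible (2 : F)] in
/-- `|det a|^{1/2} > 0`. [cite: Rangarao1993, Lemma 3.2 (1), p. 351] -/
theorem modSqrt_pos (a : (ι → F) ≃ₗ[F] (ι → F)) : 0 < modSqrt a := Real.sqrt_pos.2 (normAbs_det_pos a)

omit [Fintype ι] [DecidableEq ι] [Invertible (2 : F)] in
/-- `(|det a|^{1/2})² = |det a|`. [cite: Rangarao1993, Lemma 3.2 (1), p. 351] -/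
theorem modSqrt_sq (a : (ι → F) ≃ₗ[F] (ι → F)) :
    modSqrt a ^ 2 = (normAbs F (LinearMap.det (a : (ι → F) →ₗ[F] (ι → F))) : ℝ) :=
  Real.sq_sqrt (normAbs_det_pos a).le

omit [Fintype ι] [DecidableEq ι] [Invertible (2 : F)] in
/-- `|det (a a')|^{1/2} = |det a|^{1/2} |det a'|^{1/2}`. [cite: Rangarao1993, Thm 3.5 (3)] -/
theorem modSqrt_mul (a a' : (ι → F) ≃ₗ[F] (ι → F)) : modSqrt (a * a') = modSqrt a * modSqrt a' := by
  rw [modSqrt, modSqrt, modSqrt, ← Real.sqrt_mul (NNReal.coe_nonneg _), ← NNReal.coe_mul, ← map_mul,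
    ← LinearMap.det_comp, LinearEquiv.coe_toLinearMap_mul, Module.End.mul_eq_comp]

omit [Fintype ι] [DecidableEq ι] [Invertible (2 : F)] in
/-- `|det 1|^{1/2} = 1`. [cite: Rangarao1993, Thm 3.5 (3)] -/
theorem modSqrt_one : modSqrt (1 : (ι → F) ≃ₗ[F] (ι → F)) = 1 := by
  rw [modSqrt, LinearEquiv.coe_toLinearMap_one, LinearMap.det_id, map_one, NNReal.coe_one, Real.sqrt_one]

omit [Invertible (2 : F)] in
/-- `|det a⁻ᵀ|^{1/2} = (|det a|^{1/2})⁻¹`. [cite: WeilBNT1967, Chap. I §2 Th. 3 Cor. 3] -/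
theorem modSqrt_dualLeviPi (a : (ι → F) ≃ₗ[F] (ι → F)) : modSqrt (dualLeviPi a) = (modSqrt a)⁻¹ := by
  rw [modSqrt, modSqrt, det_dualLeviPi, map_inv₀, NNReal.coe_inv, Real.sqrt_inv]

omit [Invertible (2 : F)] in
/-- `|det aᵀ|^{1/2} = |det a|^{1/2}`. [cite: WeilBNT1967, Chap. I §2 Th. 3 Cor. 3] -/
theorem modSqrt_transposePi (a : (ι → F) ≃ₗ[F] (ι → F)) : modSqrt (transposePi a) = modSqrt a := by
  rw [modSqrt, modSqrt, det_transposePi]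

omit [Fintype ι] [DecidableEq ι] [Invertible (2 : F)] in
/-- `|det a⁻¹|^{1/2} = (|det a|^{1/2})⁻¹`. [cite: WeilBNT1967, Chap. I §2 Th. 3 Cor. 3] -/
theorem modSqrt_symm (a : (ι → F) ≃ₗ[F] (ι → F)) : modSqrt a.symm = (modSqrt a)⁻¹ := by
  rw [modSqrt, modSqrt, LinearEquiv.det_coe_symm, map_inv₀, NNReal.coe_inv, Real.sqrt_inv]

omit [Fintype ι] [DecidableEq ι] [Invertible (2 : F)] in
/-- `|det (-1)|^{1/2} = 1`. [cite: Rangarao1993, Thm 3.5 (proof: r(τ)² = r(a_S))] -/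
theorem modSqrt_neg_one : modSqrt (LinearEquiv.neg F : (ι → F) ≃ₗ[F] (ι → F)) = 1 := by
  have hsq : modSqrt (LinearEquiv.neg F : (ι → F) ≃ₗ[F] (ι → F)) ^ 2 = 1 := by
    rw [pow_two, ← modSqrt_mul]
    have : (LinearEquiv.neg F : (ι → F) ≃ₗ[F] (ι → F)) * LinearEquiv.neg F = 1 := by
      apply LinearEquiv.ext; intro x; simp [LinearEquiv.mul_apply]
    rw [this, modSqrt_one]
  have hpos := modSqrt_pos (LinearEquiv.neg F : (ι → F) ≃ₗ[F] (ι → F))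
  nlinarith [hsq, hpos]

/-- `|det a|^{1/2}` as a unit of `ℂ`. [cite: Rangarao1993, Lemma 3.2 (1), p. 351] -/
def modSqrtUnit (a : (ι → F) ≃ₗ[F] (ι → F)) : ℂˣ :=
  Units.mk0 (modSqrt a : ℂ) (Complex.ofReal_ne_zero.2 (modSqrt_pos a).ne')

omit [Fintype ι] [DecidableEq ι] [Invertible (2 : F)] in
/-- value. [cite: Rangarao1993, Lemma 3.2 (1), p. 351] -/
@[simp] theorem coe_modSqrtUnit (a : (ι → F) ≃ₗ[F] (ι → F)) : ((modSqrtUnit a : ℂˣ) : ℂ) = (modSqrt a : ℂ) := rfl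

/-- **the Levi operator `r(m(a)) : Φ ↦ |det a|^{-1/2} Φ(a⁻¹ ·)`** on `𝒮(F^ι)` (Rao's (3.8) for `p = m(a)`, left-action
form). [cite: Rangarao1993, Lemma 3.2 (1), (3.8), p. 351; Weil1964, n° 13, p. 160] -/
def leviOpPi (a : (ι → F) ≃ₗ[F] (ι → F)) : SchwartzBruhat (ι → F) ≃ₗ[ℂ] SchwartzBruhat (ι → F) :=
  scalarOp (modSqrtUnit a)⁻¹ * leviEquivSB a a.toLinearMap.continuous_on_pi a.symm.toLinearMap.continuous_on_pi

omit [DecidableEq ι] [Invertible (2 : F)] in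
/-- formula `(r(m(a)) Φ)(u) = |det a|^{-1/2} Φ(a⁻¹ u)`. [cite: Rangarao1993, Lemma 3.2 (1), (3.8), p. 351] -/
@[simp] theorem coe_leviOpPi_apply (a : (ι → F) ≃ₗ[F] (ι → F)) (f : SchwartzBruhat (ι → F)) (u : ι → F) :
    ((leviOpPi a f : SchwartzBruhat (ι → F)) : (ι → F) → ℂ) u = ((modSqrt a : ℂ))⁻¹ * (f : (ι → F) → ℂ) (a.symm u) := by
  rw [leviOpPi, LinearEquiv.mul_apply, scalarOp_apply, Units.val_inv_eq_inv_val, coe_modSqrtUnit,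
    Submodule.coe_smul, Pi.smul_apply, coe_leviEquivSB, leviOp_apply, smul_eq_mul]

omit [DecidableEq ι] [Invertible (2 : F)] in
/-- **`r(m(a a')) = r(m(a)) r(m(a'))`**. [cite: Rangarao1993, Thm 3.5 (3); Weil1964, n° 13, p. 160] -/
theorem leviOpPi_mul (a a' : (ι → F) ≃ₗ[F] (ι → F)) : leviOpPi (a * a') = leviOpPi a * leviOpPi a' := by
  apply LinearEquiv.ext; intro f; apply Subtype.ext; funext u
  rw [LinearEquiv.mul_apply, coe_leviOpPi_apply, coe_leviOpPi_apply, coe_leviOpPi_apply, modSqrt_mul,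
    Complex.ofReal_mul, mul_inv, mul_assoc]
  rfl

omit [DecidableEq ι] [Invertible (2 : F)] in
/-- `r(m(1)) = 1`. [cite: Rangarao1993, Thm 3.5 (3)] -/
theorem leviOpPi_one : leviOpPi (1 : (ι → F) ≃ₗ[F] (ι → F)) = 1 := by
  apply LinearEquiv.ext; intro f; apply Subtype.ext; funext u
  rw [coe_leviOpPi_apply, modSqrt_one, Complex.ofReal_one, inv_one, one_mul]
  rfl

omit [DecidableEq ι] [Invertible (2 : F)] in
/-- `r(m(a⁻¹)) = r(m(a))⁻¹`. [cite: Rangarao1993, Thm 3.5 (3)] -/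
theorem leviOpPi_symm (a : (ι → F) ≃ₗ[F] (ι → F)) : leviOpPi a.symm = (leviOpPi a)⁻¹ := by
  rw [eq_inv_iff_mul_eq_one, ← leviOpPi_mul]
  have : a.symm * a = 1 := by apply LinearEquiv.ext; intro x; simp [LinearEquiv.mul_apply]
  rw [this, leviOpPi_one]

omit [DecidableEq ι] [Invertible (2 : F)] in
/-- `r(m(-1)) Φ = Φ(-·)` (no scalar: `|det(-1)| = 1`). [cite: Rangarao1993, Thm 3.5 (proof), p. 356] -/
theorem coe_leviOpPi_neg_apply (f : SchwartzBruhat (ι → F)) (u : ι → F) :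
    ((leviOpPi (LinearEquiv.neg F) f : SchwartzBruhat (ι → F)) : (ι → F) → ℂ) u = (f : (ι → F) → ℂ) (-u) := by
  rw [coe_leviOpPi_apply, modSqrt_neg_one, Complex.ofReal_one, inv_one, one_mul]
  rfl

/-- **`(m(a), r(m(a))) ∈ S̃p_ψ(W)`** with `m(a) = (a, a⁻ᵀ)`: the normalised Levi operator implements the Levi
element (a scalar multiple of the tree's `leviEquivSB`, which implements by `levi_mem_MpPsi`).
[cite: MoeglinVignerasWaldspurger1987, Chap. 2 II.6; Rangarao1993, Lemma 3.2 (1)] -/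
theorem levi_leviOpPi_mem_MpPsi (a : (ι → F) ≃ₗ[F] (ι → F)) :
    (leviSp (dotProductBilin F F (m := ι)) a (dualLeviPi a) (dotProductBilin_apply_dualLeviPi a), leviOpPi a)
      ∈ MpPsi (schrodingerSB (dotProductBilin F F) ψ hl hb) := by
  have h₁ := levi_mem_MpPsi (dotProductBilin F F) ψ hl hb a (dualLeviPi a) (dotProductBilin_apply_dualLeviPi a)
    a.toLinearMap.continuous_on_pi a.symm.toLinearMap.continuous_on_pi
  have h₂ := one_scalarOp_mem_MpPsi (schrodingerSB (dotProductBilin F F (m := ι)) ψ hl hb) (modSqrtUnit a)⁻¹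
  have e : (leviSp (dotProductBilin F F (m := ι)) a (dualLeviPi a) (dotProductBilin_apply_dualLeviPi a), leviOpPi a)
      = ((1 : symplecticGroup (polar (dotProductBilin F F (m := ι)))), scalarOp (modSqrtUnit a)⁻¹) *
        (leviSp (dotProductBilin F F (m := ι)) a (dualLeviPi a) (dotProductBilin_apply_dualLeviPi a),
          leviEquivSB a a.toLinearMap.continuous_on_pi a.symm.toLinearMap.continuous_on_pi) := by
    rw [Prod.mk_mul_mk, one_mul]; rfl
  rw [e]
  exact (MpPsi _).mul_mem h₂ h₁

/-- **Levi conjugation of the unipotent operators**: `r(m(a)) r(n(c)) r(m(a))⁻¹ = r(n(a⁻ᵀ c a⁻¹))`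
(`d₀(α)⁻¹ t₀(f) d₀(α) = t₀(f^α)` at operator level). [cite: Weil1964, n° 13, p. 160; Rangarao1993, Thm 3.5 (3)] -/
theorem leviOpPi_mul_unipOpPi_mul_inv (a : (ι → F) ≃ₗ[F] (ι → F)) (c : (ι → F) →ₗ[F] (ι → F)) :
    leviOpPi a * unipOpPi hl c * (leviOpPi a)⁻¹ =
      unipOpPi hl (((dualLeviPi a : (ι → F) ≃ₗ[F] (ι → F)) : (ι → F) →ₗ[F] (ι → F)) ∘ₗ c ∘ₗ
        ((a.symm : (ι → F) ≃ₗ[F] (ι → F)) : (ι → F) →ₗ[F] (ι → F))) := by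
  rw [← leviOpPi_symm]
  apply LinearEquiv.ext; intro f; apply Subtype.ext; funext u
  rw [LinearEquiv.mul_apply, LinearEquiv.mul_apply, coe_leviOpPi_apply, coe_unipOpPi_apply, coe_leviOpPi_apply,
    coe_unipOpPi_apply, LinearEquiv.symm_symm, LinearEquiv.apply_symm_apply, modSqrt_symm, Complex.ofReal_inv, inv_inv]
  have hq : halfForm c (a.symm u) =
      halfForm (((dualLeviPi a : (ι → F) ≃ₗ[F] (ι → F)) : (ι → F) →ₗ[F] (ι → F)) ∘ₗ c ∘ₗ
        ((a.symm : (ι → F) ≃ₗ[F] (ι → F)) : (ι → F) →ₗ[F] (ι → F))) u := by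
    rw [halfForm, halfForm, LinearMap.comp_apply, LinearMap.comp_apply, LinearEquiv.coe_coe, LinearEquiv.coe_coe,
      dotProductBilin_dualLeviPi]
  rw [hq]
  have hm : ((modSqrt a : ℂ)) ≠ 0 := Complex.ofReal_ne_zero.2 (modSqrt_pos a).ne'
  field_simp

/-- the same as `r(m(a)) r(n(c)) = r(n(a⁻ᵀ c a⁻¹)) r(m(a))`. [cite: Weil1964, n° 13, p. 160; Rangarao1993, Thm 3.5 (3)] -/
theorem leviOpPi_mul_unipOpPi (a : (ι → F) ≃ₗ[F] (ι → F)) (c : (ι → F) →ₗ[F] (ι → F)) :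
    leviOpPi a * unipOpPi hl c =
      unipOpPi hl (((dualLeviPi a : (ι → F) ≃ₗ[F] (ι → F)) : (ι → F) →ₗ[F] (ι → F)) ∘ₗ c ∘ₗ
        ((a.symm : (ι → F) ≃ₗ[F] (ι → F)) : (ι → F) →ₗ[F] (ι → F))) * leviOpPi a := by
  rw [← leviOpPi_mul_unipOpPi_mul_inv hl a c, inv_mul_cancel_right]

/-- … and as `r(n(c)) r(m(a)) = r(m(a)) r(n(aᵀ c a))`. [cite: Weil1964, n° 13, p. 160; Rangarao1993, Thm 3.5 (3)] -/
theorem unipOpPi_mul_leviOpPi (a : (ι → F) ≃ₗ[F] (ι → F)) (c : (ι → F) →ₗ[F] (ι → F)) :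
    unipOpPi hl c * leviOpPi a =
      leviOpPi a * unipOpPi hl (((transposePi a : (ι → F) ≃ₗ[F] (ι → F)) : (ι → F) →ₗ[F] (ι → F)) ∘ₗ c ∘ₗ
        ((a : (ι → F) ≃ₗ[F] (ι → F)) : (ι → F) →ₗ[F] (ι → F))) := by
  rw [leviOpPi_mul_unipOpPi]
  congr 2
  apply LinearMap.ext; intro x
  simp only [LinearMap.comp_apply, LinearEquiv.coe_coe, LinearEquiv.apply_symm_apply]
  rw [← dualLeviPi_symm, LinearEquiv.apply_symm_apply]

end Ops

/-! ## §3 The Fourier operator `r(w)` -/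

section Fourier

variable {F : Type*} [Field F] [ValuativeRel F] [TopologicalSpace F] [IsNonarchimedeanLocalField F]
  {ι : Type*} [Fintype ι] [DecidableEq ι] [Invertible (2 : F)]
  {ψ : AddChar F Circle} (hl : IsLocallyConstant (⇑ψ : F → Circle))
  (hb : ∀ y : ι → F, Continuous fun u : ι → F => dotProductBilin F F u y)
  [MeasurableSpace F] [BorelSpace F] (μ : Measure F) [μ.IsAddHaarMeasure] {m : ℤ}

omit [DecidableEq ι] [Invertible (2 : F)] in
/-- **the Fourier operator `r(w) : Φ ↦ Φ̂`, `Φ̂(η) = ∫ ψ(⟨x, η⟩) Φ(x) dμ^⊗ι(x)`** on `𝒮(F^ι)` for the product Haar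
measure (Rao's `r(τ)`, (3.9) with `S = {1,…,n}`; the tree's `piFourierEquivSB`).
[cite: Rangarao1993, §3.1 (3.9), Lemma 3.2 (2), p. 351; Weil1964, n° 13, p. 160] -/
def fourierOpPi (hψ : ψ.IsContinuousNontrivial) (hm : ψ.HasConductorExp m) :
    SchwartzBruhat (ι → F) ≃ₗ[ℂ] SchwartzBruhat (ι → F) :=
  haveI : SecondCountableTopology F := secondCountableTopology_localField F
  piFourierEquivSB (Measure.pi fun _ : ι => μ) hψ hm

omit [DecidableEq ι] [Invertible (2 : F)] in
/-- formula `(r(w) Φ)(η) = ∫ ψ(x ⬝ᵥ η) Φ(x) dμ^⊗ι`. [cite: Rangarao1993, §3.1 (3.9), p. 349] -/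
theorem coe_fourierOpPi (hψ : ψ.IsContinuousNontrivial) (hm : ψ.HasConductorExp m) (f : SchwartzBruhat (ι → F)) :
    ((fourierOpPi μ hψ hm f : SchwartzBruhat (ι → F)) : (ι → F) → ℂ) =
      piFourierSB ψ (Measure.pi fun _ : ι => μ) f :=
  haveI : SecondCountableTopology F := secondCountableTopology_localField F
  coe_piFourierEquivSB _ hψ hm f

omit [DecidableEq ι] in
/-- **`(w, r(w)) ∈ S̃p_ψ(W)`** for the Weyl element `w : (x, y) ↦ (y, -x)`: the Fourier operator implements `w`
(the tree's `piWeylPair_mem_mpPairs`). [cite: Weil1964, n° 13, p. 160; Rangarao1993, Lemma 3.2 (2)] -/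
theorem weyl_fourierOpPi_mem_MpPsi (hψ : ψ.IsContinuousNontrivial) (hm : ψ.HasConductorExp m) :
    (weylSp (dotProductBilin F F (m := ι)) (LinearEquiv.refl F (ι → F)) (LinearEquiv.neg F) dotProductBilin_refl_neg',
      fourierOpPi μ hψ hm) ∈ MpPsi (schrodingerSB (dotProductBilin F F) ψ hl hb) := by
  haveI : SecondCountableTopology F := secondCountableTopology_localField F
  rw [mem_MpPsi, ofSymplectic_weylSp]
  exact piWeylPair_mem_mpPairs (Measure.pi fun _ : ι => μ) hψ hm

omit [DecidableEq ι] [Invertible (2 : F)] [BorelSpace F] in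
/-- the self-duality constant of the product of a self-dual measure is `1`:
`μ^⊗ι(𝒪^ι) μ^⊗ι((𝔭^m)^ι) = (μ(𝒪) μ(𝔭^m))^{|ι|} = 1`. [cite: WeilBNT1967, Ch. VII §2, Cor. 3] -/
theorem piSelfDualConst_pi_eq_one [BorelSpace F] (hψ : ψ.IsContinuousNontrivial) (hm : ψ.HasConductorExp m)
    (hμ : IsSelfDualMeasure ψ μ) : piSelfDualConst F ι (Measure.pi fun _ : ι => μ) m = 1 := by
  haveI : SecondCountableTopology F := secondCountableTopology_localField F
  have h1 : selfDualConst μ m = 1 := (isSelfDualMeasure_iff μ hψ.1 hm).1 hμ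
  have hbox : ∀ N : ℤ, (Measure.pi fun _ : ι => μ).real (piPrimePowBall F ι N) =
      μ.real (primePowBall F N) ^ Fintype.card ι := by
    intro N
    rw [piPrimePowBall, measureReal_def, Measure.pi_pi, ENNReal.toReal_prod, Finset.prod_const, Finset.card_univ,
      measureReal_def]
  have h0 := measureReal_mul_measureReal_eq_selfDualConst μ (m := m) 0
  rw [sub_zero] at h0
  rw [piSelfDualConst, hbox, hbox, ← mul_pow, h0, h1, one_pow]

omit [DecidableEq ι] [Invertible (2 : F)] in
/-- **`r(w) r(w) = r(m(-1))`** (`Φ ↦ Φ(-·)`) for a SELF-DUAL `μ` — Rao's "`r(τ_S)² = r(a_S)`, since the Haar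
measures are dual to each other". [cite: Rangarao1993, Thm 3.5 (proof), p. 356; WeilBNT1967, Ch. VII §2, Cor. 3] -/
theorem fourierOpPi_mul_fourierOpPi (hψ : ψ.IsContinuousNontrivial) (hm : ψ.HasConductorExp m)
    (hμ : IsSelfDualMeasure ψ μ) :
    fourierOpPi μ hψ hm * fourierOpPi μ hψ hm = leviOpPi (LinearEquiv.neg F : (ι → F) ≃ₗ[F] (ι → F)) := by
  haveI : SecondCountableTopology F := secondCountableTopology_localField F
  apply LinearEquiv.ext; intro f; apply Subtype.ext; funext u
  rw [LinearEquiv.mul_apply, coe_leviOpPi_neg_apply, fourierOpPi, coe_piFourierEquivSB_piFourierEquivSB,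
    piSelfDualConst_pi_eq_one μ hψ hm hμ, Complex.ofReal_one]
  exact one_mul _

omit [Invertible (2 : F)] in
/-- change of variables in the Fourier integral: `(r(m(a)) Φ)^(η) = |det a|^{1/2} Φ̂(aᵀ η)`.
[cite: WeilBNT1967, Chap. I §2 Th. 3 Cor. 3; Weil1964, n° 13, p. 160] -/
theorem piFourierSB_leviOpPi (a : (ι → F) ≃ₗ[F] (ι → F)) (f : SchwartzBruhat (ι → F)) (η : ι → F) :
    piFourierSB ψ (Measure.pi fun _ : ι => μ) (leviOpPi a f : SchwartzBruhat (ι → F)) η =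
      (modSqrt a : ℂ) * piFourierSB ψ (Measure.pi fun _ : ι => μ) f (transposePi a η) := by
  haveI : SecondCountableTopology F := secondCountableTopology_localField F
  rw [piFourierSB_apply, piFourierSB_apply]
  -- the integrand after substitution
  set g : (ι → F) → ℂ := fun y => ((ψ (y ⬝ᵥ transposePi a η) : Circle) : ℂ) * (f : (ι → F) → ℂ) y with hg
  have hcv := integral_comp_linearEquiv μ a.symm g
  have hint : (fun x : ι → F => ((ψ (x ⬝ᵥ η) : Circle) : ℂ) *
      ((leviOpPi a f : SchwartzBruhat (ι → F)) : (ι → F) → ℂ) x) = fun x => ((modSqrt a : ℂ))⁻¹ * g (a.symm x) := by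
    funext x
    rw [coe_leviOpPi_apply, hg]
    simp only
    rw [dotProduct_transposePi, LinearEquiv.apply_symm_apply]
    ring
  rw [hint, integral_const_mul, hcv, LinearEquiv.det_coe_symm, inv_inv, Complex.real_smul]
  have hsq : (((normAbs F (LinearMap.det (a : (ι → F) →ₗ[F] (ι → F))) : ℝ≥0) : ℝ) : ℂ) = (modSqrt a : ℂ) ^ 2 := by
    rw [← Complex.ofReal_pow, modSqrt_sq]
  rw [hsq]
  have hm0 : ((modSqrt a : ℂ)) ≠ 0 := Complex.ofReal_ne_zero.2 (modSqrt_pos a).ne'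
  field_simp

omit [Invertible (2 : F)] in
/-- **the contragredient rule `r(w) r(m(a)) = r(m(a⁻ᵀ)) r(w)`** (`w m(a) w⁻¹ = m(a⁻ᵀ)`; exact thanks to the
normalisation `|det a|^{-1/2}`). [cite: Weil1964, n° 13, p. 160; Rangarao1993, Thm 3.5 (3)] -/
theorem fourierOpPi_mul_leviOpPi (hψ : ψ.IsContinuousNontrivial) (hm : ψ.HasConductorExp m)
    (a : (ι → F) ≃ₗ[F] (ι → F)) :
    fourierOpPi μ hψ hm * leviOpPi a = leviOpPi (dualLeviPi a) * fourierOpPi μ hψ hm := by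
  haveI : SecondCountableTopology F := secondCountableTopology_localField F
  apply LinearEquiv.ext; intro f; apply Subtype.ext; funext η
  rw [LinearEquiv.mul_apply, LinearEquiv.mul_apply, coe_fourierOpPi, piFourierSB_leviOpPi, coe_leviOpPi_apply,
    coe_fourierOpPi, modSqrt_dualLeviPi, Complex.ofReal_inv, inv_inv, dualLeviPi_symm]

end Fourier

end Literature.RepresentationTheory.HeisenbergGroup
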